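import Mathlib.Analysis.SpecialFunctions.Exp
import Mathlib.Order.Filter.AtTopBot.Field
import Literature.Analysis.FluidPDE.HyperbolicDSSOrbit
import Literature.Analysis.FluidPDE.SuitableWeak
import HarnessLib

/-!
# Crux `DssTruncationBridge` (stmt-NavierStokesRegularity-14477), line `registered`: STUB
# `stub_singularPoint_of_orbitShadowing` — the shadowed DSS orbit forces a singular point

Lands `--supports stmt-NavierStokesRegularity-14477` the registered stub
`stub_singularPoint_of_orbitShadowing` of the birth skeleton
`Cruxes/DssTruncationBridge/Lines/birth.lean` (thesis `DssFarFieldSlaving.DssTruncationBridge`).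

Statement. Let `u` be rotated `c`-DSS (`IsRotatedDSS c R u`, `1 < c`), so that its backward
similarity orbit `U = lerayOrbit u`, `U(s, y) = e^{-s/2} u(−e^{−s}, e^{−s/2} y)`, satisfies the
twisted periodicity `U(s + 2 log c, y) = R⁻¹ U(s, R y)` (accepted
`IsRotatedDSS.lerayOrbit_add_period`). Let `0 < T` and let the orbit about `(T, 0)` of an
arbitrary field `v`, `V = lerayOrbit (fun τ x => v (τ + T) x)`, shadow `U` in sup norm for all
`s ≥ s₀` up to an error `ε` exceeded somewhere by the profile orbit, `ε < ‖U(s₁, y₁)‖`. Then `v`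
is unbounded at nonnegative times inside every backward parabolic cylinder `Q_r(T, 0)`.

Proof (scaling + twisted periodicity only). The amplitude `a = ‖U(s₁, y₁)‖ > ε` recurs at the
similarity times `s = s₁ + 2k log c` at the points `R^{-k} y₁` of the same norm
(`norm_lerayOrbit_recurs`); there `‖V(s, ·)‖ ≥ a − ε > 0`, i.e.
`‖v(T − e^{−s}, e^{−s/2} R^{-k} y₁)‖ ≥ (a − ε) e^{s/2}`, and for `k` large the physical point
`(T − e^{−s}, e^{−s/2} R^{-k} y₁)` lies in `Q_r(T, 0)` with `T − e^{−s} ≥ 0` while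
`(a − ε) e^{s/2} > M` (limits `e^{−s} → 0`, `e^{−s/2} → 0`, `e^{s/2} → ∞`, then Archimedes in `k`).
-/

noncomputable section

open Set Filter Topology Literature.Analysis.FluidPDE

set_option linter.dupNamespace false

namespace Summit.NavierStokesRegularity.NavierStokesRegularity.Theorems

/-- Physical space `ℝ³` (the notation of the registered stub header). -/
local notation "E3" => EuclideanSpace ℝ (Fin 3)

/-- **Iterated twisted periodicity.** For a rotated `c`-DSS field (`0 < c`) the amplitude
`‖U(s₁, y₁)‖` of the backward similarity orbit `U = lerayOrbit u` recurs at every similarity time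
`s₁ + k · (2 log c)`, `k : ℕ`, at a point of the same norm (namely `R^{-k} y₁`): iterate
`U(s + 2 log c, R⁻¹ y) = R⁻¹ U(s, y)` (`IsRotatedDSS.lerayOrbit_add_period`) and use that `R` is an
isometry. [folklore] -/
private theorem norm_lerayOrbit_recurs {c : ℝ}
    {R : EuclideanSpace ℝ (Fin 3) ≃ₗᵢ[ℝ] EuclideanSpace ℝ (Fin 3)}
    {u : ℝ → EuclideanSpace ℝ (Fin 3) → EuclideanSpace ℝ (Fin 3)}
    (h : IsRotatedDSS c R u) (hc : 0 < c) (s₁ : ℝ) (y₁ : EuclideanSpace ℝ (Fin 3)) (k : ℕ) :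
    ∃ y : EuclideanSpace ℝ (Fin 3), ‖y‖ = ‖y₁‖ ∧
      ‖lerayOrbit u (s₁ + k * (2 * Real.log c)) y‖ = ‖lerayOrbit u s₁ y₁‖ := by
  induction k with
  | zero => exact ⟨y₁, rfl, by simp⟩
  | succ k ih =>
    obtain ⟨y, hy, hU⟩ := ih
    refine ⟨R.symm y, by rw [LinearIsometryEquiv.norm_map, hy], ?_⟩
    have hsplit : s₁ + ((k + 1 : ℕ) : ℝ) * (2 * Real.log c) =
        s₁ + (k : ℝ) * (2 * Real.log c) + 2 * Real.log c := by
      push_cast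
      ring
    rw [hsplit, h.lerayOrbit_add_period hc, LinearIsometryEquiv.norm_map, R.apply_symm_apply, hU]

/-- **Stub 1 of line `registered` of crux `DssTruncationBridge`**
(`stub_singularPoint_of_orbitShadowing`; scaling + twisted periodicity only). If `u` is rotated
`c`-DSS with `1 < c`, `0 < T`, and the backward similarity orbit about `(T, 0)` of a field `v`,
`V = lerayOrbit (fun τ x => v (τ + T) x)`, shadows `U = lerayOrbit u` in sup norm for all `s ≥ s₀`
up to an error `ε` with `ε < ‖U(s₁, y₁)‖` somewhere, then `v` is unbounded at nonnegative times on
every backward parabolic cylinder `Q_r(T, 0)`: the amplitude `a = ‖U(s₁, y₁)‖` recurs at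
`(s₁ + 2k log c, R^{-k} y₁)` (twisted periodicity `U(s + 2 log c, y) = R⁻¹ U(s, R y)` of rotated
DSS orbits in similarity variables, Bradshaw–Tsai's (V-RDSS)), where `‖V‖ ≥ a − ε > 0`, i.e.
`‖v(T − e^{−s}, e^{−s/2} R^{-k} y₁)‖ ≥ (a − ε) e^{s/2} → ∞`, and these physical points eventually
lie in `Q_r(T, 0) ∩ {t ≥ 0}`. [cite: BradshawTsai2017CPDE, §1 (V-RDSS)] -/
theorem stub_singularPoint_of_orbitShadowing :
    ∀ (c : ℝ) (R : E3 ≃ₗᵢ[ℝ] E3) (u v : ℝ → E3 → E3) (T s₀ ε : ℝ),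
      1 < c → IsRotatedDSS c R u → 0 < T →
      (∃ (s : ℝ) (y : E3), ε < ‖lerayOrbit u s y‖) →
      (∀ s : ℝ, s₀ ≤ s → ∀ y : E3,
          ‖lerayOrbit (fun τ x => v (τ + T) x) s y - lerayOrbit u s y‖ ≤ ε) →
      ∀ r : ℝ, 0 < r → ∀ M : ℝ,
        ∃ z ∈ parabolicCylinder r ((T : ℝ), (0 : E3)), 0 ≤ z.1 ∧ M < ‖v z.1 z.2‖ := by
  intro c R u v T s₀ ε hc hdss hT hgap hshadow r hr M
  obtain ⟨s₁, y₁, hgap⟩ := hgap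
  have hc0 : 0 < c := one_pos.trans hc
  have hP : 0 < 2 * Real.log c := mul_pos two_pos (Real.log_pos hc)
  have haε : 0 < ‖lerayOrbit u s₁ y₁‖ - ε := sub_pos.2 hgap
  -- the three elementary limits in the similarity time `s`
  have hA : Tendsto (fun s : ℝ => Real.exp (-s)) atTop (𝓝 0) :=
    Real.tendsto_exp_neg_atTop_nhds_zero
  have hB : Tendsto (fun s : ℝ => Real.exp (-s / 2)) atTop (𝓝 0) :=
    Real.tendsto_exp_atBot.comp (tendsto_neg_atTop_atBot.atBot_div_const two_pos)
  have hC : Tendsto (fun s : ℝ => Real.exp (s / 2)) atTop atTop :=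
    Real.tendsto_exp_atTop.comp (tendsto_id.atTop_div_const two_pos)
  have e1 : ∀ᶠ s in atTop, Real.exp (-s) < r ^ 2 := hA.eventually_lt_const (by positivity)
  have e2 : ∀ᶠ s in atTop, Real.exp (-s) < T := hA.eventually_lt_const hT
  have e3 : ∀ᶠ s in atTop, Real.exp (-s / 2) * ‖y₁‖ < r := by
    have h := hB.mul_const ‖y₁‖
    rw [zero_mul] at h
    exact h.eventually_lt_const hr
  have e4 : ∀ᶠ s in atTop, M / (‖lerayOrbit u s₁ y₁‖ - ε) < Real.exp (s / 2) :=
    hC.eventually_gt_atTop _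
  have e5 : ∀ᶠ s in atTop, s₀ ≤ s := eventually_ge_atTop s₀
  obtain ⟨S, hS⟩ := eventually_atTop.1 (e1.and (e2.and (e3.and (e4.and e5))))
  -- a late similarity time of the form `s₁ + k · (2 log c)` (Archimedes)
  obtain ⟨k, hk⟩ := exists_nat_ge ((S - s₁) / (2 * Real.log c))
  have hs : S ≤ s₁ + k * (2 * Real.log c) := by
    have hk' := (div_le_iff₀ hP).1 hk
    linarith
  obtain ⟨h1, h2, h3, h4, h5⟩ := hS _ hs
  obtain ⟨y, hy, hU⟩ := norm_lerayOrbit_recurs hdss hc0 s₁ y₁ k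
  set s : ℝ := s₁ + k * (2 * Real.log c) with hs_def
  -- shadowing at `(s, y)` and the reverse triangle inequality: `‖V(s, y)‖ ≥ a − ε`
  have hsh := hshadow s h5 y
  have hVeq : ‖lerayOrbit (fun τ x => v (τ + T) x) s y‖ =
      Real.exp (-s / 2) * ‖v (-Real.exp (-s) + T) (Real.exp (-s / 2) • y)‖ := by
    have hdef : lerayOrbit (fun τ x => v (τ + T) x) s y =
        Real.exp (-s / 2) • v (-Real.exp (-s) + T) (Real.exp (-s / 2) • y) := rfl
    rw [hdef, norm_smul, Real.norm_of_nonneg (Real.exp_pos _).le]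
  have hV : ‖lerayOrbit u s₁ y₁‖ - ε ≤
      Real.exp (-s / 2) * ‖v (-Real.exp (-s) + T) (Real.exp (-s / 2) • y)‖ := by
    have hrev := norm_sub_norm_le (lerayOrbit u s y) (lerayOrbit (fun τ x => v (τ + T) x) s y)
    rw [norm_sub_rev, hVeq, hU] at hrev
    linarith
  -- the witness: the physical point `(T − e^{−s}, e^{−s/2} y)`
  refine ⟨(-Real.exp (-s) + T, Real.exp (-s / 2) • y), ?_, ?_, ?_⟩
  · rw [mem_parabolicCylinder]
    refine ⟨⟨?_, ?_⟩, ?_⟩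
    · show T - r ^ 2 < -Real.exp (-s) + T
      linarith
    · show -Real.exp (-s) + T < T
      linarith [Real.exp_pos (-s)]
    · show dist (Real.exp (-s / 2) • y) (0 : EuclideanSpace ℝ (Fin 3)) < r
      rw [dist_zero_right, norm_smul, Real.norm_of_nonneg (Real.exp_pos _).le, hy]
      exact h3
  · show 0 ≤ -Real.exp (-s) + T
    linarith
  · show M < ‖v (-Real.exp (-s) + T) (Real.exp (-s / 2) • y)‖
    have hM : M < Real.exp (s / 2) * (‖lerayOrbit u s₁ y₁‖ - ε) := (div_lt_iff₀ haε).1 h4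
    have hee : Real.exp (s / 2) * Real.exp (-s / 2) = 1 := by
      rw [← Real.exp_add, show s / 2 + -s / 2 = 0 by ring, Real.exp_zero]
    calc M < Real.exp (s / 2) * (‖lerayOrbit u s₁ y₁‖ - ε) := hM
      _ ≤ Real.exp (s / 2) *
            (Real.exp (-s / 2) * ‖v (-Real.exp (-s) + T) (Real.exp (-s / 2) • y)‖) :=
          mul_le_mul_of_nonneg_left hV (Real.exp_pos _).le
      _ = ‖v (-Real.exp (-s) + T) (Real.exp (-s / 2) • y)‖ := by
          rw [← mul_assoc, hee, one_mul]

end Summit.NavierStokesRegularity.NavierStokesRegularity.Theorems
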